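import Literature.NumberTheory.Automorphic.ShimuraCurveRibetTakahashi
import Summits.BirchSwinnertonDyer.Rank1Residual.Additive.WildThreeRefinedKolyvagin
import HarnessLib
import HarnessLib.Audit.Tags

/-!
# O6 — THE QUATERNIONIC TRANSFER OF THE TAMAGAWA PRODUCT AT A WILD `3` (target `T-O6-R5`)
# (cell `b2b-bsdres`, team o5o6, seat O6-planner-2 "non-Iwasawa side", GEN 5; a TARGET
# FORMULATION — `def … : Prop` only, NOTHING asserted; one bookkeeping theorem)

HONEST FRAMING (cell `b2b-bsdres`, run/shared/lean/b2b/bsd-rank1-residual/, verbatim in every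
file): the goal of the cell is to DELETE the COMBINATION-SHAPED residual classes of the
Birch–Swinnerton-Dyer formula for ALL analytic-rank `≤ 1` elliptic curves over `ℚ` — assembled
STRICTLY from published theorems — so that the rank-`≤ 1` remainder becomes exactly the
CONSTRUCTION-SHAPED classes, which are TYPED (missing-input `Prop`s), NOT attempted. This is not
"finishing BSD". Research routes; no claim beyond stated classes; census output = EVIDENCE /
conjecture items, never a Literature fact. NOTHING below is asserted — `def … : Prop` only; the one
`theorem` is divisibility bookkeeping (`T-O6-R5 ⇒` its census avatar).

## What gen 4 left, and what this file types

Gen 4 (file `Additive/WildThreeRefinedKolyvagin.lean`) isolated the class-level input of the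
Heegner side at a wild `3` as the DIVISIBILITY half `RKC3Divisibility` (T1⁺: `M_∞ ≥ t`,
`t = ord₃ ∏_q c_q(E)`, PRODUCT form) and recorded that the only printed non-Iwasawa engine —
Jetchev 2008 (Thm. 1.4 / 6.3: stringent Kummer structures at the bad primes + ONE auxiliary
Kolyvagin prime) — yields the MAX form `M_∞ ≥ max_q ord₃ c_q` only. WHY MAX, NOT SUM (read in the
held text, arXiv:math/0703431 pp. 12–16): Prop. 4.9 puts every class `κ_{c,m}` in the stringent
structure at ALL bad primes at once, but at a core vertex `c` the Selmer module `H_{F(c)}^{ε}` is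
CYCLIC (Thm. 6.3), so its image in `⊕_q (Kum/Kum⁰)_q ≅ ⊕_q ℤ/3^{e_q}` has order `≤ 3^{max e_q}`; the
missing defect lives in the non-cyclic dual relaxed module, a Kolyvagin prime relaxes ONE cyclic
line per sign (Lemma 6.1) and the sign flips at each step. So the named residue of gen 4,
**R-O6-5** := wild `∧` towerSurj(3) `∧` `n₃ ≥ 2` (at least two primes `q` with `3 ∣ c_q`; `4 532`
rank-1 / `1 679` rank-0 classes with `N < 5·10⁵`, kit j126140), was labelled "surplus `t − max`
reached by NO non-Iwasawa method in print".

THIS FILE CORRECTS THAT LABEL for the multiplicative part of the surplus. The product form IS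
reached without Iwasawa theory, by MOVING the Tamagawa-`3` primes INTO THE QUATERNION ALGEBRA
(Jetchev–Skinner–Wan 2017 §7.4.2; W. Zhang 2014 §10): for an admissible `N = D·M` (`D` = an even set
of primes `q ∥ N`, inert in the auxiliary imaginary quadratic `K''`; `M ⊇ 27·(rest)`, split) the
Kolyvagin–Nekovář bound for the Heegner point `z_{D,M}` of the SHIMURA curve `X₀^D(M)`
(`#Ш(E/K'')[p^∞] ≤ p^{2 ord_p [E(K''):ℤ z_{D,M}]}`, JSW Thm. 19 = Nekovář 2007, hypotheses as printed:
`E[p]` irreducible and (H) — NO `p ∤ N`; the `p ∣ N` reading is FLAGGED for the referee exactly as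
`KolyvaginStructureThreeShape` was) combined with the Gross–Zagier formula ON `X₀^D(M)` (Yuan–Zhang–
Zhang; explicit: Cai–Shu–Tian; in W. Zhang's form, Lemma 10.1(1) p. 244:
`[E(K):ℤ z]² · δ_{1,N}/δ_{D,M} = c² #Ш ∏_{q∣M} c_q² ∏_{q∣D} c_q` as the BSD-shaped identity) gives
  `ord₃ #Ш(E/K'') ≤ ord₃ #Ш_an(E/K'') + 2 Σ_{q∣M} ord₃ c_q + [Σ_{q∣D} ord₃ c_q(E/K''_q) − ord₃(δ_{1,N}/δ_{D,M})]`,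
so the Tamagawa defect of the Kolyvagin upper bound at the primes of `D` is EXACTLY the `3`-adic
defect of the RIBET–TAKAHASHI degree ratio `γ_{D,M,E} := (δ_{1,N}/δ_{D,M}) / ∏_{q∣D} v_q(Δ_E)`
(Pasten 2024 §6.2 p. 20; `v_q(Δ_E) = c_q(E/K''_q)` for `q` inert). The tree ALREADY has this
vocabulary (`Literature/NumberTheory/Automorphic/ShimuraCurve*.lean`, built for `Summits/ABC`):
`IsAdmissibleFactorization N D M`, `ShimuraCurveData D M`, `ShimuraParametrizationData X W'` with
`deg` and `IsMinimalFor` (`= δ_{D,M}`), the classical datum's `modularDegree` (`= δ_{1,N}`), and the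
named facts `PastenShimura2024_thm_6_1` (numerator of `γ` supported on primes `≤ 163`),
`PastenShimura2024_thm_6_1_b`, `PastenShimura2024_pairwise_denominator`, with Pasten's §6.6–6.9
PERFORMED in `ShimuraCurveRibetTakahashiCokernelProofs.lean` over the component-group orders
`i_p = cI`, `j_p = cJ` as section variables. None of those facts is exact AT THE PRIME `3`
(`3 ≤ 163`). The target typed here is that exactness:

* `RTGammaThreeUnitAt`  — per instance: `γ_{D,M,E}` is a `3`-adic unit
  (`δ_{1,N} · b = a · δ_{D,M} · ∏_{q∣D} v_q(Δ_E)` with `3 ∤ a b`);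
* `QuaternionicTamagawaTransferAtThree` (**T-O6-R5**, `@[conjecture]`): it holds for every `E/ℚ` with
  `E[3]` irreducible and every admissible `N = D M`. EVIDENCE (printed antecedents, pages of the held
  arXiv text 1705.09251): by Prop. 6.13 (= Ribet–Takahashi 1997 Thm. 2, "`M` need not be squarefree",
  p. 23) `δ_{d,prM}/δ_{dpr,M} = c_p(A_{d,prM}) c_r(A_{dpr,M}) / (i_p(d,prM)² j_r(dpr,M)²)`; at `ℓ = 3`
  with `E[3]` irreducible: the isogeny factors of Lemma 6.8 are `3`-units (no `3`-isogeny in the class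
  ⇒ `Φ_p[3^∞]` is an isogeny invariant), the image terms `i_p` are `3`-units (Lemma 6.14's proof:
  `i_p ∣ r + 1 − a_r` for all `r ∤ N`, and `a_r ≡ r + 1 (mod 3)` for all `r` would make `ρ̄₃^{ss}`
  reducible), and the cokernel terms satisfy `v₃(j_p(D,M)) = v₃(j_r(D,M))` for `p, r ∣ D` (Lemma 6.15
  with `α_{S,1}(3) = 0` per curve), `j_p ∣ p − 1` (Lemma 6.18 ← Papikian–Rabinoff Cor. 3.5) and
  `v₃(j_p) ≤ v₃(c_{r'}(E))` for any multiplicative `r' ∣ D` (6.15) or `r' ∣ M` when `M` has `≥ 2`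
  multiplicative primes (6.16). HENCE THE PROVED CASE **R5a** (`QuaternionicTamagawaTransferAtThreeKnownCase`,
  a theorem-chain in print, to be DERIVED in the tree from the `RTSystem` section variables plus the
  two inputs `j_p ∣ p − 1` and `3`-sharp isogeny invariance — ask A-O6-J8): `γ` is a `3`-unit as soon
  as SOME prime `q₀ ∣ D` has `q₀ ≢ 1 (mod 3)` or `3 ∤ v_{q₀}(Δ_E)` (put `q₀` in the first pair of the
  telescoping chain; then every chain discriminant contains `q₀`), or `M` keeps two multiplicative
  primes one with `3 ∤ v(Δ)`. The OPEN RESIDUAL **R5b**: every prime of `D` is `≡ 1 (mod 3)` with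
  `3 ∣ v_q(Δ_E)` and no multiplicative prime with `3 ∤ v(Δ)` is usable — exactly Takahashi 2001
  Thm. 2.4's asserted surjectivity `j = 1`, whose proof has a gap (Pasten p. 24, Papikian–Rabinoff §1).
  In Helm–Hamidi language R5b says: the maximal ideal `m = (3, f)` is NOT CONTROLLABLE at any prime
  of `D` (`ρ̄₃` unramified at `q ∣ D` — Tate: `3 ∣ v_q(Δ)` — and `q ≡ ±1 (mod 3)`, automatic at
  `ℓ = 3`), the locus where multiplicity one of the character group `X_q(J₀^D(M))_m` FAILS
  (Hamidi 2026 Thm. 5.5 / Prop. 5.6, stated for `ℓ > 3`: `dim J^D(M)[m] = 2^{k+1}`). PRINT STATUS of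
  the SQUAREFREE shadow (`N` squarefree, `E[ℓ]` irreducible ⇒ `ℓ ∤ i_p · j_p`): asserted in print —
  Ribet–Takahashi 1997 Thm. 1 (second part; its proof USES `M` squarefree, Pasten p. 23), Takahashi
  2001 Thm. 2.7 (`r ∣ M`: `ord_ℓ j_r = ord_ℓ c_r` by level-lowering), and Hamidi 2026 §9.2 ("by
  [Ribet–Takahashi, Khare 2003], if `ρ̄_m` is irreducible the cokernel of `Φ_p(J^D(M)) → Φ_p(A^D(M))`
  is trivial locally at `m`"; his Thm. C: the cokernel is NOT trivial in general — curve 102c, `D = 6`,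
  at `ℓ = 2` with `E[2]` reducible, Remark 9.3). So the irreducibility hypothesis is of the right
  type, the squarefree case is (reportedly) a theorem, and what is OPEN is the non-squarefree level
  (`27 ∣ M` here; any `9 ∣ N` in the census) at non-controllable `D`-primes.
* `RTDegreeDivisibilityAtThree` — the CENSUS AVATAR (F-R5-deg): `3^{Σ_{q∣D} ord₃ v_q(Δ_E)} ∣ δ_{1,N}`
  (`δ_{D,M} ∈ ℕ`), a consequence of `RTGammaThreeUnitAt` PROVED below
  (`rtDegreeDivisibilityAtThree_of_gammaThreeUnitAt`) and checkable from Cremona's `alldegphi`.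
  Since T-O6-R5 quantifies over EVERY admissible `D`, the sharp test is
  `ord₃ δ_{1,N} ≥ max_{D even, D ⊆ Mult(E)} Σ_{q∈D} ord₃ v_q(Δ_E)`; run 2026-08-21 on every `9 ∣ N`,
  mod-`3`-surjective curve with `N < 5·10⁵` having `≥ 2` multiplicative primes and a positive
  right-hand side — `145 426` curves (wild `27 ∣ N`: `21 495` r1 + `15 485` r0; tame: `62 239` r1 +
  `46 207` r0), **0 violations**, equality attained on `28 068` tame curves, margin `≥ 1` on every wild
  curve (indeed `3 ∣ δ_{1,N}` for all `154 058` mod-`3`-surjective curves with `27 ∣ N`). Direct check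
  against the only printed table of Shimura degrees (Deines 2014, Table 5.1, squarefree `N < 100`,
  53 pairs `(E, D)`): `ord₃ γ = 0` on every class without a rational `3`-isogeny (incl. the `3`-loaded
  rows 33a/`D = 33`, 77c/`D = 77`), the only non-zero values (`−1, −2`, computed from class-constant
  data) sitting exactly on the 16 rows whose class HAS a `3`-isogeny, i.e. outside the hypothesis.
  ALL-CONDUCTOR run (same day, `gen5/o6r2g5_frdeg_all.py`, every Cremona curve `N < 5·10⁵` whose class
  has no rational `3`-isogeny, sharp `D`): **`1 021 838` curves tested, `0` violations, `344 685`
  equalities** (squarefree `N`: `374 993` tested; `3 ∈ D` when `3 ∥ N`: `266 412` tested; `27 ∣ N`: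
  `41 810` tested with NO equality — at a wild `3` the inequality is always strict, observation O-R5-w).
  Refinement of R5b (`gen5/o6r2g5_r5b_frob.py`): `ρ̄₃(Frob_q)` is SCALAR (`±1`; cube test on
  `Δ/q^{v_q(Δ)} mod q`) at both primes of the best `D` on `0` of the `32` R5b rows (at one prime on 2:
  330057g1/bh1, `q = 31`) — Ribet's multiplicity-two-by-scalar-Frobenius locus is empty there; control:
  the cube test returns `158/158` on normaliser-of-Cartan images (forced) and `0.348` at `3 ∤ v_q(Δ)`.
  Files `gen5/o6r2g5_r5_partition_v2.{py,tsv}`, `o6r2g5_r5_summary_v2.json`, `o6r2g5_r5b_rows.tsv`,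
  `o6r2g5_deines_check.py` of the seat directory.

## What the transfer does to R-O6-5 (census, same run; EVIDENCE, not a claim of proof)

Per class, with `Mult` = the multiplicative primes (`q ∥ N`, so `q ≠ 3`; geometric component number
`n_q = v_q(Δ_E)`, arithmetic Tamagawa number `c_q`), `A3` = additive `q ≠ 3` with `c_q = 3` (IV/IV*),
`h₃ = [3 ∣ c₃]`: EVERY even subset `D ⊆ Mult` is tried; the level residue is
`L(D) = {3 if h₃} ∪ A3 ∪ {q ∈ Mult ∖ D : 3 ∣ c_q}` (level primes split in `K''`, Tamagawa numbers over
`ℚ_q` unchanged; the `D`-primes' inert-place Tamagawa numbers `n_q` are cancelled EXACTLY by the degree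
ratio when `γ` is a `3`-unit), with surplus `s_L = t_L − max_L` = what a level-side Jetchev argument on
`X₀^D(M)` (the `X₀^D(M)`-analogue of `T-O6-J`: Jetchev 2008 Thm. 1.4 is printed for `X₀(N)` only, JSW
Remark 20 — a TYPED GAP `T-O6-J^D`) would still leave. Rank 1 (`4 532`): **`3 006`** reach `s_L = 0` with
RT-exactness in the PROVED case R5a (`269` with NO Tamagawa-`3` prime left in the level — transfer
alone; `2 737` keeping exactly one, which `T-O6-J^D` absorbs), **`5`** reach `s_L = 0` only through an
R5b pair (`297297l1, 297297z1, 349650er1, 471744cd1, 471744gb1`), **`1 521`** keep an irreducible level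
surplus (`s = 1`: `1 487`, `2`: `33`, `3`: `1`; `819` of them have `≤ 1` multiplicative prime, so no
transfer exists: both Tamagawa-`3` primes additive, typically `(3 : IV/IV*, 2 : IV/IV*)`). Rank 0
(`1 679`): `1 122` (`149 + 973`) / `5` (`235872bg1, 250344j1, 422712e1, 491400ca1, 491400eb1`) / `552`.
So **R-O6-5′** := the R-O6-5 rows with `≥ 2` Tamagawa-`3` primes among `{3} ∪ A3 ∪ (Mult ∖ D)` for
every admissible `D` — `1 521` r1 / `552` r0 — is the HONEST residue of the non-Iwasawa side; the other
`3 011` r1 / `1 127` r0 rows are reduced to: Nekovář's bound at `p = 3 ∣ N` (hypothesis reading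
flagged), GZ on `X₀^D(M)` with `27 ∣ M` (Yuan–Zhang–Zhang; explicit Cai–Shu–Tian), `T-O6-R5` (R5a
proved chain; R5b on `5 + 5` rows), `T-O6-J^D` (on `2 737 + 973` rows), `3 ∤` the Manin constant of
`X₀^D(M) → E'` (DEFINITION REQUESTS D-O6-R5-1: CM points on `ShimuraCurveData` and the quaternionic
Heegner point `z_{D,M} ∈ E(K'')`; D-O6-R5-2: Nekovář 2007 at `p = 3` as a named-fact SHAPE), and — for
BSD₃ over `ℚ` — the rank-`0` `3`-part of the twist `E^{D''}` (N11 / O6 rank-0 side, unchanged). The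
tame cell O5 has the same shape: r1 `3 334 = 2 858 + 11 + 465`, r0 `1 468 = 1 243 + 11 + 214`.

Antecedents (EVIDENCE labels; PDF pages of the materialised texts):
[corpus:paper:arxiv-1512.06894 p0004 (outline), p0017 ((H), (gen-H)), p0019 (Thm. 19, Remark 20),
p0030 (δ_{N⁺,N⁻} = ∏_{ℓ∣N⁻} c_ℓ up to p-unit, (eq:gz for K')), p0031 (§7.4.2 choice of N⁻ ⊇ Tamagawa-p
primes, K'')]; [corpus:paper:doi-10-4310-cjm-2014-v2-n2-a2 p0039 (Thm. 6.4 and the non-squarefree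
remark: #Ram(ρ̄) ≥ 1, Helm for q ≡ ±1 mod p), p0043 (p. 233 "Tamagawa factors at N⁻q exactly cancel
η"), p0054–p0055 (Lemma 10.1, δ_{N⁺,N⁻}, Thm. 10.2)]; [corpus:paper:arxiv-1705.09251 p0012 (δ_{D,M},
admissible), p0020 (γ_{D,M,E}, Thm. 6.1), p0022 (Lemma 6.8), p0023 (Prop. 6.13 = RT Thm. 2 without
squarefree M; Lemma 6.14), p0024 (Lemmas 6.15, 6.16, Thm. 6.17; Takahashi's gap), p0025 (Lemma 6.18,
§6.9)]; [corpus:paper:arxiv-math_0703431 p0012–p0016 (Jetchev Prop. 4.9, Lemma 6.1, Thm. 6.3)];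
[corpus:paper:doi-10-1006-jnth-2000-2614 p0007 (Takahashi 2001 Thm. 2.4 — gapped — and Thm. 2.7),
p0009–p0010 (Thm. 3.2, Cor. 3.5 "Bertolini–Darmon formula")]; [corpus:paper:arxiv-2607.23244 p0002
(Hamidi 2026 Thms. A–D), p0008–p0009 (Def. 5.2 controllable, Thm. 5.3 = Helm, Thm. 5.5), p0012 (not
controllable ⟺ unramified and `q ≡ ±1 mod ℓ`), p0021–p0023 (Tables 1–3, Thm. 9.1, Thm. C via 102c,
Remark 9.3, §9.2.2 first paragraph)]; Ribet–Takahashi 1997 itself NOT held (acq-02186 joined);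
Khare 2003 (Invent. Math. 154) NOT held;
tree: `Literature.NumberTheory.Automorphic.PastenShimura2024_thm_6_1`, `_thm_6_1_b`,
`_pairwise_denominator`, `PastenShimura2024_lemma_6_15/6_16/6_14`, `twoPrimeStep_of_ribetTakahashi_inputs`;
galaxy: no hits for "Ribet-Takahashi|Takahashi" ∧ "p=3|additive" beyond the held items (star all,
2026-08-21; remote OpenAlex/S2 rate-limited). DEAD at `p = 3` and NOT used: Bertolini–Darmon
admissible primes (`p ∤ ℓ² − 1` impossible), Gross–Parson Thm. 2 (d), f)), BD 1999 Thm. 1.3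
(`p ∤ 2N deg`), Pollack–Weston Thm. 6.8 / Zhang Thm. 6.4 as stated (`p ≥ 5`, definite case).
-/

namespace Summit.BirchSwinnertonDyer.Rank1Residual.AdditiveThree

open scoped Classical
open Literature.NumberTheory.Automorphic
open Literature.NumberTheory.EllipticCurves.ModularForms (ModularParametrizationData IsNewformOf)
open WeierstrassCurve

/-! ## §1. `γ_{D,M,E}` is a `3`-adic unit — the per-instance statement -/

section PerInstance

variable {N D M : ℕ} [NeZero N] {X : ShimuraCurveData D M} (W : WeierstrassCurve ℚ) [W.IsElliptic]
  {W₁ : WeierstrassCurve ℚ} [W₁.IsElliptic] (D₁ : ModularParametrizationData W₁ N)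
  {W' : WeierstrassCurve ℚ} (P : ShimuraParametrizationData X W')

/-- **`γ_{D,M,E}` is a `3`-adic unit** (Pasten 2024 §6.2 p. 20: `δ_{1,N}/δ_{D,M} = γ_{D,M,E} ·
∏_{p∣D} v_p(Δ_E)`), in the tree's rendering of `PastenShimura2024_thm_6_1`: `δ_{1,N}` =
`D₁.modularDegree` (a classical datum carrying the newform of `W`, of minimal degree — the binders
are supplied by the global statement below), `δ_{D,M}` = `P.deg` for a class-minimal Shimura datum,
`v_p(Δ_E)` = `(W.minimalDiscriminantNorm ℤ).factorization p` for the globally minimal `W`; "`x` is a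
`3`-adic unit" = `x = a/b` for SOME positive `a, b` prime to `3`. A predicate; nothing asserted.
[cite: PastenShimura2024, §6.2 p. 20 (definition of γ_{D,M,E})] -/
def RTGammaThreeUnitAt : Prop :=
  ∃ a b : ℕ, 0 < a ∧ 0 < b ∧ ¬ 3 ∣ a ∧ ¬ 3 ∣ b ∧
    D₁.modularDegree * b = a * P.deg * ∏ p ∈ D.primeFactors, (W.minimalDiscriminantNorm ℤ).factorization p

/-- **F-R5-deg, the census avatar**: `3^{Σ_{p∣D} ord₃ v_p(Δ_E)}` divides the modular degree
`δ_{1,N}`. Checkable per curve from Cremona's `alldegphi` and `allcurves` (Kodaira data); run of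
2026-08-21 (sharp form, every even `D ⊆ Mult(E)`): `0` violations on `145 426` curves (`9 ∣ N`, mod-`3`
surjective, `N < 5·10⁵`), `28 068` equalities; all-conductor run (no rational `3`-isogeny in the class):
`0` violations on `1 021 838` curves, `344 685` equalities. A predicate; nothing asserted. [folklore] -/
def RTDegreeDivisibilityAtThree (D : ℕ) : Prop :=
  3 ^ (∑ p ∈ D.primeFactors, ((W.minimalDiscriminantNorm ℤ).factorization p).factorization 3) ∣
    D₁.modularDegree

omit [W.IsElliptic] [W₁.IsElliptic] in
/-- `γ_{D,M,E}` a `3`-unit ⇒ `3^{Σ ord₃ v_p(Δ)} ∣ δ_{1,N}` (since `δ_{D,M}` and `a` are integers and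
`3 ∤ b`). The implication that makes F-R5-deg a NECESSARY condition of `T-O6-R5`. [folklore] -/
theorem rtDegreeDivisibilityAtThree_of_gammaThreeUnitAt (h : RTGammaThreeUnitAt W D₁ P) :
    RTDegreeDivisibilityAtThree W D₁ D := by
  obtain ⟨a, b, -, -, -, hb3, heq⟩ := h
  set s := ∑ p ∈ D.primeFactors, ((W.minimalDiscriminantNorm ℤ).factorization p).factorization 3
  have hprod : 3 ^ s ∣ ∏ p ∈ D.primeFactors, (W.minimalDiscriminantNorm ℤ).factorization p := by
    rw [← Finset.prod_pow_eq_pow_sum]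
    exact Finset.prod_dvd_prod_of_dvd _ _ fun p _ => Nat.ordProj_dvd _ _
  have h1 : 3 ^ s ∣ D₁.modularDegree * b := by
    rw [heq]
    exact Dvd.dvd.mul_left hprod _
  have hcop : Nat.Coprime (3 ^ s) b :=
    Nat.Coprime.pow_left _ ((Nat.Prime.coprime_iff_not_dvd Nat.prime_three).2 hb3)
  exact hcop.dvd_of_dvd_mul_right h1

end PerInstance

/-! ## §2. The target `T-O6-R5` and its proved case -/

/-- **T-O6-R5 — THE QUATERNIONIC TRANSFER OF THE TAMAGAWA PRODUCT AT `3`** ("Ribet–Takahashi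
exactness at `ℓ = 3`"): for every globally minimal elliptic `W/ℚ` of conductor `N` whose mod-`3`
representation is IRREDUCIBLE, every admissible factorisation `N = D M` (`D` squarefree with an even
number of prime factors, coprime to `M`; `M` arbitrary — `27 ∣ M` is the O6 use), every Shimura curve
datum `X` of level `(D, M)`, every classical datum `D₁` carrying the newform of `W` and of minimal
degree among such (`δ_{1,N}`), and every class-minimal Shimura datum `P` (`δ_{D,M}`):
`γ_{D,M,E}` is a `3`-adic unit, i.e. `ord₃(δ_{1,N}/δ_{D,M}) = Σ_{q∣D} ord₃ v_q(Δ_E)`.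
WHY IT MIGHT FAIL: the cokernel `j_q` of `Φ_q(J₀^D(M)) → Φ_q(A_{D,M})` (`q ∣ D`) is only known to divide
`q − 1` (Papikian–Rabinoff) and `c_{r}(E)` for other multiplicative `r` (Pasten 6.15/6.16) — when every
multiplicative prime of `E` is `≡ 1 (mod 3)` with `3 ∣ v_q(Δ)` (`m = (3,f)` not controllable at any prime
of `D`: character-group multiplicity one fails there, Hamidi 2026 Thm. 5.5), a `3` in `j_q` is not
excluded in print for NON-SQUAREFREE `M` (Takahashi's unconditional surjectivity claim has a gap and is
false at reducible `ℓ = 2`, Hamidi Thm. C; the squarefree-`N` irreducible case is asserted in print by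
Ribet–Takahashi 1997 Thm. 1 / Khare 2003 per Hamidi §9.2). USE: with Nekovář's bound and GZ on `X₀^D(M)` it removes the
`D`-part of the Tamagawa defect of the Kolyvagin upper bound at `3` (module docstring), reducing the
gen-4 residue R-O6-5 to R-O6-5′. OPEN; EVIDENCE / conjecture item of the cell, NOT a Literature fact;
its printed antecedents are Pasten 2024 §6 (Prop. 6.13 = Ribet–Takahashi Thm. 2, Lemmas 6.8, 6.14,
6.15, 6.16, 6.18), W. Zhang 2014 Thm. 6.4 (the `p ≥ 5` definite analogue), JSW 2017 §7.4.2 (the use).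
Census avatar `RTDegreeDivisibilityAtThree` (sharp, all even `D`): 0 / 145 426 violations, 28 068 equalities
on the `9 ∣ N` cell and 0 / 1 021 838, 344 685 equalities on all conductors `N < 5·10⁵` (2026-08-21).
[cite: PastenShimura2024, Prop. 6.13 and Lemma 6.14 p. 23, Lemmas 6.15–6.16 p. 24, Lemma 6.18 p. 25]
[cite: WZhang2014, Thm. 6.4 (p. 229) and Lemma 10.1 (p. 244)]
[cite: JetchevSkinnerWan2017, Thm. 19 (p. 19) and §7.4.2 (p. 31)] -/
@[conjecture] def QuaternionicTamagawaTransferAtThree : Prop :=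
  ∀ {N D M : ℕ} [NeZero N], IsAdmissibleFactorization N D M →
    ∀ (X : ShimuraCurveData D M) (W : WeierstrassCurve ℚ) [W.IsElliptic] [W.IsGloballyMinimal],
      W.conductorNorm ℤ = N → W.HasIrreducibleModPGaloisRep 3 →
    ∀ (W₁ : WeierstrassCurve ℚ) [W₁.IsElliptic] (D₁ : ModularParametrizationData W₁ N),
      IsNewformOf W D₁.f →
      (∀ (W₂ : WeierstrassCurve ℚ) [W₂.IsElliptic] (D₂ : ModularParametrizationData W₂ N),
          D₂.f = D₁.f → D₁.modularDegree ≤ D₂.modularDegree) →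
    ∀ (W' : WeierstrassCurve ℚ) [W'.IsElliptic] (P : ShimuraParametrizationData X W'),
      P.IsMinimalFor W → RTGammaThreeUnitAt W D₁ P

/-- **R5a — the PROVED CASE of T-O6-R5, as a theorem-chain in print** (NOT yet derived in the tree;
typing ask A-O6-J8: derive it inside the `RTSystem` section of
`ShimuraCurveRibetTakahashiCokernelProofs.lean` from `h613`, `hJc`, the Eisenstein input at `ℓ = 3`
per curve, `3`-sharp Lemma 6.8, and the extra input `cJ P p ∣ p − 1` = Pasten Lemma 6.18 ←
Papikian–Rabinoff Cor. 3.5): the same conclusion under the extra hypothesis that SOME prime `q₀ ∣ D`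
has `q₀ ≢ 1 (mod 3)` or `3 ∤ v_{q₀}(Δ_E)`. Reason (Pasten §6.9 telescoping with `q₀` in the first
pair): every chain discriminant `Dᵢ ∋ q₀`, and `v₃(j_{rᵢ}(Dᵢ,mᵢ)) = v₃(j_{q₀}(Dᵢ,mᵢ)) ≤
min(v₃(q₀ − 1), v₃(v_{q₀}(Δ_E))) = 0` (Lemma 6.15 at `ℓ = 3` with `α_{S,1}(3) = 0` for `E[3]`
irreducible; Lemma 6.18; `j ∣ #Φ`). Stated as a `Prop` (a target for the typers), NOT asserted.
[cite: PastenShimura2024, Lemma 6.15 p. 24, Lemma 6.18 p. 25, §6.9 p. 25] -/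
def QuaternionicTamagawaTransferAtThreeKnownCase : Prop :=
  ∀ {N D M : ℕ} [NeZero N], IsAdmissibleFactorization N D M →
    (∃ q₀ ∈ D.primeFactors, q₀ % 3 ≠ 1) ∨
      (∀ (W : WeierstrassCurve ℚ) [W.IsElliptic], W.conductorNorm ℤ = N →
        ∃ q₀ ∈ D.primeFactors, ¬ 3 ∣ (W.minimalDiscriminantNorm ℤ).factorization q₀) →
    ∀ (X : ShimuraCurveData D M) (W : WeierstrassCurve ℚ) [W.IsElliptic] [W.IsGloballyMinimal],
      W.conductorNorm ℤ = N → W.HasIrreducibleModPGaloisRep 3 →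
    ∀ (W₁ : WeierstrassCurve ℚ) [W₁.IsElliptic] (D₁ : ModularParametrizationData W₁ N),
      IsNewformOf W D₁.f →
      (∀ (W₂ : WeierstrassCurve ℚ) [W₂.IsElliptic] (D₂ : ModularParametrizationData W₂ N),
          D₂.f = D₁.f → D₁.modularDegree ≤ D₂.modularDegree) →
    ∀ (W' : WeierstrassCurve ℚ) [W'.IsElliptic] (P : ShimuraParametrizationData X W'),
      P.IsMinimalFor W → RTGammaThreeUnitAt W D₁ P

/-- The conjecture contains its proved case (bookkeeping: the extra hypothesis is simply dropped).
[folklore] -/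
theorem knownCase_of_quaternionicTamagawaTransferAtThree (h : QuaternionicTamagawaTransferAtThree) :
    QuaternionicTamagawaTransferAtThreeKnownCase := by
  intro N D M _ hadm _ X W _ _ hWN hirr W₁ _ D₁ hnew hmin W' _ P hP
  exact h hadm X W hWN hirr W₁ D₁ hnew hmin W' P hP

/-- T-O6-R5 implies its census avatar at every instance (so ONE curve with
`ord₃ δ_{1,N} < Σ_{q∣D} ord₃ v_q(Δ_E)` for an admissible `D` refutes T-O6-R5). [folklore] -/
theorem rtDegreeDivisibility_of_quaternionicTamagawaTransferAtThree
    (h : QuaternionicTamagawaTransferAtThree) {N D M : ℕ} [NeZero N]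
    (hadm : IsAdmissibleFactorization N D M) (X : ShimuraCurveData D M) (W : WeierstrassCurve ℚ)
    [W.IsElliptic] [W.IsGloballyMinimal] (hWN : W.conductorNorm ℤ = N)
    (hirr : W.HasIrreducibleModPGaloisRep 3) (W₁ : WeierstrassCurve ℚ) [W₁.IsElliptic]
    (D₁ : ModularParametrizationData W₁ N) (hnew : IsNewformOf W D₁.f)
    (hmin : ∀ (W₂ : WeierstrassCurve ℚ) [W₂.IsElliptic] (D₂ : ModularParametrizationData W₂ N),
      D₂.f = D₁.f → D₁.modularDegree ≤ D₂.modularDegree)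
    (W' : WeierstrassCurve ℚ) [W'.IsElliptic] (P : ShimuraParametrizationData X W')
    (hP : P.IsMinimalFor W) : RTDegreeDivisibilityAtThree W D₁ D :=
  rtDegreeDivisibilityAtThree_of_gammaThreeUnitAt W D₁ P (h hadm X W hWN hirr W₁ D₁ hnew hmin W' P hP)

end Summit.BirchSwinnertonDyer.Rank1Residual.AdditiveThree
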